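import Literature.AlgebraicGeometry.ShimuraVarieties.UnitaryShimuraCurveRecordMorphisms
import Literature.AlgebraicGeometry.ShimuraVarieties.UnitaryShimuraPiecesUnderHeckeTranslate
import Literature.AlgebraicGeometry.ShimuraVarieties.UnitaryBallSpecialSourceFrame
import Literature.AlgebraicGeometry.Morphisms.CofanPieceFactorization
import Literature.NumberTheory.Automorphic.UnitaryGroupRationalRepresentatives
import HarnessLib

/-!
# The geometric seesaw SOURCE satisfies the four compatibility clauses of III-8′ ([Liu 2021] proof of Thm. 4.15, l. 2207 / l. 2212)

Topic `AlgebraicGeometry/ShimuraVarieties`; namespaces `Literature.AlgebraicGeometry.ShimuraVarieties` (§0) and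
`…ShimuraVarieties.UnitaryCanonicalModel` (§§1–6).  PROOF FILE: theorems only — no definition, no named fact, no instance, no `sorry`.

[Liu2021] proves Thm. 4.15 by restricting a class to the sub-Shimura curve of `G⋆ = Res U(V⋆) ↪ G = Res U(V)` along an orthogonal
decomposition `V = V⋆ ⊕ V⋆^⊥` (FJcycle.tex l. 2193–2208), and detects it there by the [MurtyRamakrishnan1992]-type sentence l. 2212.
In the tree the detecting sentence is the named fact ★ III-8′ `UnitaryBallUniformisationDatum.MR92Prop6Source`, read on `L`-data by ★
`MR92Prop6Source.exists_line_detecting_of_forall` (`UnitaryBallH1RestrictionSubfieldCode.lean`): a class `c ≠ 0` on a compact ball quotient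
`(X, D)` is detected by EVERY uniformised special curve `(Y, D₁, φ, M)` satisfying four clauses read at `(H, τ, Γ′, W₀)` — (hgram)
`Mᴴ·H^τ·M = D₁.Hℂ`, (horth) `⟪τ∘v, M u⟫ = 0` for `v ∈ W₀`, (hgroup) every `γ₁ ∈ D₁.Γ` is `M`-intertwined with `τ(γ′)` for some
`γ′ ∈ Γ′`, (hunif) `φ(ℂ) ∘ unif₁ = unif ∘ M` on the cone.  THIS FILE proves that the source the GS construction actually provides — a
PIECE of the canonical model of the unitary Shimura CURVE ★ `RecordSystemGS` (`UnitaryShimuraCurveRecord.lean`) mapped into a PIECE of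
the canonical model of `Sh(U(H), 𝔹²)` ★ `RecordSystem` by an embedding of canonical models ★ `RecordSystemGS.IsEmbedding`
(`UnitaryShimuraCurveRecordMorphisms.lean`; [Deligne1979ShimuraVarieties] 2.2.6, [Milne2005ShimuraVarieties] Thm. 13.6) — satisfies them.

SETTING (§1).  `S : RecordSystem L H τ T hT K₀`, `Sstar : RecordSystemGS L Jstar τ K₀⋆`, a frame `ᵗ(cB)·(a·H)·B = J⋆ ⊕ J⊥` with
`τ a` a positive real, an embedding `ιe : M⋆_{K⋆} ⟶ M_K` acting as ★ `ShimuraSetGS.embPoints` (`φGS(K⋆) ≤ K`), ONE target piece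
`ι q : X q ⟶ (M_K)_τ` of a colimit cofan with its ball datum `Bq` (`Hℂ = H^τ`, uniformised through the representative `gq`: the clauses
of ★ `RecordSystem.pieces`), ONE source piece `ιs : Y ⟶ (M⋆_{K⋆})_τ` with its disc datum `D₁` (`Hℂ = J⋆^τ`, group clause and
uniformisation through the representative `gs`: the clauses of ★ `RecordSystemGS.pieces`), and the REPRESENTATIVE BOOKKEEPER
`γ ∈ U(H)(L⁺)` with `gq⁻¹ · γ_f · φGS(gs) ∈ K` (it exists iff the source piece lands in the target piece; at the identity pieces
`γ = γ₁ · embRational(γ⋆)⁻¹`, §5).  The representatives `g_q` of [Milne2005ShimuraVarieties] Lemma 5.13 are NOT assumed to be `1`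
on the identity class (`g q₁ = γ₁_f·k` in general), which is why `M` carries `γ^τ`.

RESULTS.  With `B′ := γ·B` (again a frame: §0 `formCongr_mul_of_mem_rational`) and `M := (√re τa : ℂ) • τ(B′·(e₁|e₂))`:
§2 `map_baseChange_emb_map_source_unif` — `(ιe)_τ(ιs(unif₁ v)) = ι_q(unif_q(B′^τ(v ⊕ 0)))` on the source cone; §3 the four clauses
`source_gram` / `source_orthogonal` (line `W₀ := L ∙ (B′ e₃)`) / `source_group` (`Γ′ := Γ_H(gq K gq⁻¹)`, witness `B′(δ ⊕ 1)B′⁻¹`,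
`δ ∈ Γ_{J⋆}(gs K⋆ gs⁻¹)` the rational matrix of `γ₁`) / `source_unif_comp`; §4 `exists_fac_source` — the factorisation
`φ : Y ⟶ X q`, `φ ≫ ι q = ιs ≫ (ιe)_τ` (★ `Morphisms.exists_fac_of_isColimit_cofan_of_mem`) — and the bundle `exists_fac_and_fourClauses`;
§5 the identity pieces: `bookkeeper_of_rational_reps` and `lastCol_bookkeeper_mul_eq` (`(γ₁·embRational(γ⋆)⁻¹·B) e₃ = (γ₁·B) e₃`, so a
consumer holding a frame `B₀` of a PRESCRIBED line `W₀ = L ∙ (B₀ e₃)` feeds the frame `γ₁⁻¹·B₀` and reads `W₀` back); §6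
`exists_fac_pullback_ne_zero` — the detecting `∀ (Y D₁ φ M), four clauses → φ(ℂ)^* c ≠ 0` text of ★ GS-7c / ★
`HComp.RecordSystem.exists_pieces_detectingLine` (verbatim for this `Γ′`, `W₀`) applied to the GS source: `φ^* c ≠ 0`.

Cell `hodgecm-mathlib` (D-0151), crux `HLiu418` (24832), GS programme node (7-src) (A-plan1's (7-main) lead KEY; A-plan2's memo
`GS-PROGRAMME.md` A.11).  HC_CM is NOT proved here; nothing in this file discharges a printed-citation binder by itself, and III-8′
([MurtyRamakrishnan1992] not held) enters §6 only as a hypothesis text.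

## References
* [Liu2021] Y. Liu, *Fourier–Jacobi cycles and arithmetic relative trace formula*, Camb. J. Math. 9 (2021) = arXiv:2102.11518, proof of
  Thm. 4.15, FJcycle.tex l. 2193–2213 (pp. 50–51).
* [Milne2005ShimuraVarieties] J. S. Milne, *Introduction to Shimura varieties* (2005/2017): §5 (5.1) p. 56, Lemma 5.13 p. 57, Thm. 13.6 p. 118.
* [Deligne1979ShimuraVarieties] P. Deligne, *Variétés de Shimura* (1979): 2.1.2–2.1.4, 2.2.5–2.2.6.
* [BergeronMillsonMoeglin2016Balls] N. Bergeron, J. Millson, C. Moeglin, Acta Math. 216 (2016): Part 2 §§1.1–1.3, 3.1.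
* [PlatonovRapinchuk1994] V. Platonov, A. Rapinchuk, *Algebraic Groups and Number Theory* (1994): §§2.3, 4.1, 5.1.
* [Kudla1984] S. Kudla, *Seesaw dual reductive pairs* (1984), §1.
* [GortzWedhorn2020] U. Görtz, T. Wedhorn, *Algebraic Geometry I* (2nd ed.): Lemma 1.19 (1), §(3.5) Example 3.11.
* [MurtyRamakrishnan1992] V. K. Murty, D. Ramakrishnan, CRM 1992, Prop. 6 (locator from [Liu2021], unverified; not held).
-/

set_option autoImplicit false

noncomputable section

open Function MulAction Topology NumberField CategoryTheory CategoryTheory.Limits Matrix AlgebraicGeometry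
open scoped Matrix ComplexOrder
open Literature.AlgebraicGeometry.Motives
open Literature.NumberTheory.Automorphic Literature.NumberTheory.Automorphic.UnitaryGroup
open Literature.NumberTheory.Automorphic.Liu2021.AppendixC (C5.OpenCompactSubgroup C5.SmallLevel)
open Literature.Geometry.ComplexHyperbolic Literature.Geometry.ComplexHyperbolic.BallModel
open Literature.NumberTheory.Automorphic.ShimuraDissection

namespace Literature.AlgebraicGeometry.ShimuraVarieties

/-! ## §0 Linear algebra over `(L, c, τ)`: isometries, frames translated by a rational element, scalings -/

section Algebra

variable {L : Type} [Field L] [NumberField L] [IsCMField L] (τ : L →+* ℂ) {H : Matrix (Fin 3) (Fin 3) L}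

/-- `τ ∘ c = conj ∘ τ` for the CM involution coerced to a ring hom (plumbing). [folklore] -/
private theorem map_coe_complexConj (x : L) :
    τ (((IsCMField.complexConj L : L ≃ₐ[↥(maximalRealSubfield L)] L) : L →+* L) x) = starRingEnd ℂ (τ x) :=
  embedding_cmConjRingHom L τ x

/-- **A frame translated by a rational isometry is a frame with the same Gram data**: for `γ ∈ U(H)(L⁺)`,
`ᵗ(c(γB))·(a·H)·(γB) = ᵗ(cB)·(a·H)·B` (`U(H)(L⁺) = U(a·H)(L⁺)` acts on frames of `a·H` without changing the Gram matrix).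
[cite: PlatonovRapinchuk1994, §2.3] [cite: BergeronMillsonMoeglin2016Balls, Part 2 §1.2 and §3.1] -/
theorem formCongr_mul_of_mem_rational (γ : ↥(rational (↥(maximalRealSubfield L)) L (IsCMField.complexConj L) 3 H))
    (B : GL (Fin 3) L) (a : L) :
    formCongr ((IsCMField.complexConj L : L ≃ₐ[↥(maximalRealSubfield L)] L) : L →+* L) ((γ : GL (Fin 3) L) * B) (a • H) =
      formCongr ((IsCMField.complexConj L : L ≃ₐ[↥(maximalRealSubfield L)] L) : L →+* L) B (a • H) := by
  have hγ := mem_unitaryGroupOfForm_iff.1 γ.2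
  have hγa : (((γ : GL (Fin 3) L) : Matrix (Fin 3) (Fin 3) L).map
        ((IsCMField.complexConj L : L ≃ₐ[↥(maximalRealSubfield L)] L) : L →+* L))ᵀ * (a • H) *
        ((γ : GL (Fin 3) L) : Matrix (Fin 3) (Fin 3) L) = a • H := by
    rw [Matrix.mul_smul, Matrix.smul_mul, hγ]
  calc formCongr ((IsCMField.complexConj L : L ≃ₐ[↥(maximalRealSubfield L)] L) : L →+* L) ((γ : GL (Fin 3) L) * B) (a • H)
      = ((B : Matrix (Fin 3) (Fin 3) L).map ((IsCMField.complexConj L : L ≃ₐ[↥(maximalRealSubfield L)] L) : L →+* L))ᵀ *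
          ((((γ : GL (Fin 3) L) : Matrix (Fin 3) (Fin 3) L).map
            ((IsCMField.complexConj L : L ≃ₐ[↥(maximalRealSubfield L)] L) : L →+* L))ᵀ * (a • H) *
            ((γ : GL (Fin 3) L) : Matrix (Fin 3) (Fin 3) L)) * (B : Matrix (Fin 3) (Fin 3) L) := by
        simp only [formCongr, Units.val_mul, Matrix.map_mul, Matrix.transpose_mul, Matrix.mul_assoc]
    _ = formCongr ((IsCMField.complexConj L : L ≃ₐ[↥(maximalRealSubfield L)] L) : L →+* L) B (a • H) := by
        rw [hγa]

omit [NumberField L] [IsCMField L] in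
/-- `(a • H)^τ = τ a • H^τ`. [folklore] -/
private theorem map_smul_eq_smul_map (a : L) : (a • H).map τ = τ a • H.map τ := by
  ext i j
  simp only [Matrix.map_apply, Matrix.smul_apply, smul_eq_mul, map_mul]

/-- `⟪u, c • v⟫ = c · ⟪u, v⟫` over `ℂ`. [folklore] -/
private theorem hermForm_smul_right' {m : Type*} [Fintype m] (Hc : Matrix m m ℂ) (c : ℂ) (u v : m → ℂ) :
    hermForm (starRingEnd ℂ) Hc u (c • v) = c * hermForm (starRingEnd ℂ) Hc u v := by
  rw [hermForm_starRingEnd, hermForm_starRingEnd, mulVec_smul, dotProduct_smul, smul_eq_mul]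

/-- `⟪u, v⟫_{c • Hc} = c · ⟪u, v⟫_{Hc}` over `ℂ`. [folklore] -/
private theorem hermForm_smul_matrix' {m : Type*} [Fintype m] (Hc : Matrix m m ℂ) (c : ℂ) (u v : m → ℂ) :
    hermForm (starRingEnd ℂ) (c • Hc) u v = c * hermForm (starRingEnd ℂ) Hc u v := by
  rw [hermForm_starRingEnd, hermForm_starRingEnd, Matrix.smul_mulVec, dotProduct_smul, smul_eq_mul]

/-- `⟪t • v, y⟫ = c(t) · ⟪v, y⟫` over `(L, c)`. [folklore] -/
private theorem hermForm_smul_left' {R : Type*} [CommRing R] {m : Type*} [Fintype m] (σ : R →+* R) (Hm : Matrix m m R)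
    (t : R) (v y : m → R) : hermForm σ Hm (t • v) y = σ t * hermForm σ Hm v y := by
  have h : (σ ∘ (t • v)) = σ t • (σ ∘ v) := by
    funext i; simp only [Function.comp_apply, Pi.smul_apply, smul_eq_mul, map_mul]
  simp only [hermForm, h, smul_dotProduct, smul_eq_mul]

omit [NumberField L] [IsCMField L] in
/-- The square of `√(re τa)` read in `ℂ` is `τ a` when `τ a` is a positive real. [folklore] -/
private theorem sqrt_re_mul_self_eq {a : L} (hτa : 0 < (τ a).re) (hτa' : (τ a).im = 0) :
    ((Real.sqrt (τ a).re : ℂ)) * (Real.sqrt (τ a).re : ℂ) = τ a := by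
  rw [← Complex.ofReal_mul, Real.mul_self_sqrt hτa.le]
  exact Complex.ext (by simp) (by simp [hτa'])

omit [NumberField L] [IsCMField L] in
/-- The column shape of the frame embedding read through `τ`: `τ(B′·(e₁|e₂))·v = B′^τ(v ⊕ 0) = frameEmbNeg τ B′ v`.
[cite: Kudla1984, §1] -/
private theorem submatrix_map_mulVec_eq_frameEmbNeg (B' : GL (Fin 3) L) (v : Fin 2 → ℂ) :
    (((B' : Matrix (Fin 3) (Fin 3) L).submatrix id Fin.castSucc).map τ) *ᵥ v = UnitaryCanonicalModel.frameEmbNeg τ B' v := by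
  rw [show (((B' : Matrix (Fin 3) (Fin 3) L).submatrix id Fin.castSucc).map τ) =
      (((B' : Matrix (Fin 3) (Fin 3) L).map τ).submatrix id Fin.castSucc) from rfl, submatrix_castSucc_mulVec]
  rfl

omit [NumberField L] [IsCMField L] in
/-- `frameEmbNeg` along a translated frame: `(γB)^τ(v ⊕ 0) = γ^τ · B^τ(v ⊕ 0)`. [cite: Kudla1984, §1] -/
private theorem frameEmbNeg_mul (γ B : GL (Fin 3) L) (v : Fin 2 → ℂ) :
    UnitaryCanonicalModel.frameEmbNeg τ (γ * B) v =
      ((γ : Matrix (Fin 3) (Fin 3) L).map τ) *ᵥ UnitaryCanonicalModel.frameEmbNeg τ B v := by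
  unfold UnitaryCanonicalModel.frameEmbNeg
  rw [Units.val_mul, Matrix.map_mul, mulVec_mulVec]

omit [NumberField L] [IsCMField L] in
/-- `𝔹` depends only on the vector (proof-irrelevance helper; the tree's version in ★ `UnitaryShimuraCurveEmbeddingPoints` is private). [folklore] -/
private theorem negConeToBall_congr' {T : GL (Fin 3) ℂ} (hT : formCongr (starRingEnd ℂ) T (H.map τ) = BallModel.J) {v w : Fin 3 → ℂ}
    (hv : v ∈ negCone (H.map τ)) (hw : w ∈ negCone (H.map τ)) (h : v = w) :
    UnitaryCanonicalModel.negConeToBall hT hv = UnitaryCanonicalModel.negConeToBall hT hw := by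
  subst h; rfl

end Algebra

/-! ## §1 The setting -/

namespace UnitaryCanonicalModel

variable {L : Type} [Field L] [NumberField L] [IsCMField L] {Jstar : Matrix (Fin 2) (Fin 2) L} {τ : L →+* ℂ}
  {K₀s : C5.OpenCompactSubgroup ↥(finAdelic (↥(maximalRealSubfield L)) L (IsCMField.complexConj L) 2 Jstar)}
  {H : Matrix (Fin 3) (Fin 3) L} {T : GL (Fin 3) ℂ} {hT : formCongr (starRingEnd ℂ) T (H.map τ) = BallModel.J}
  {K₀ : C5.OpenCompactSubgroup ↥(finAdelic (↥(maximalRealSubfield L)) L (IsCMField.complexConj L) 3 H)}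
  (Sstar : RecordSystemGS L Jstar τ K₀s) (S : RecordSystem L H τ T hT K₀)
  (Jperp : Matrix (Fin 1) (Fin 1) L) (B : GL (Fin 3) L) {a : L} (ha : a ≠ 0)
  (hB : formCongr ((IsCMField.complexConj L : L ≃ₐ[↥(maximalRealSubfield L)] L) : L →+* L) B (a • H) = finSum 2 1 Jstar Jperp)
  (hτa : 0 < (τ a).re) (hτa' : (τ a).im = 0)
  -- the levels and the embedding (u2)
  {Kstar : C5.SmallLevel K₀s} {K : C5.SmallLevel K₀}
  (hK : Kstar.1.1.map (φGS L Jstar Jperp H B ha hB) ≤ K.1.1)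
  {ιe : Sstar.M.obj Kstar ⟶ S.M.obj K}
  -- ONE target piece of a colimit cofan of `(M_K)_τ`, with its ball datum and representative `gq`
  {Ξ : Type} {X : Ξ → SchemeOver ℂ} {ι : ∀ q, X q ⟶ (Motives.baseChangeHom τ).obj (S.M.obj K)}
  (q : Ξ) (Bq : UnitaryBallUniformisationDatum 2 (X q)) (gq : finAdelic (↥(maximalRealSubfield L)) L (IsCMField.complexConj L) 3 H)
  -- ONE source piece of `(M⋆_{K⋆})_τ`, with its disc datum and representative `gs`
  {Y : SchemeOver ℂ} (D₁ : UnitaryBallUniformisationDatum 1 Y) (ιs : Y ⟶ (Motives.baseChangeHom τ).obj (Sstar.M.obj Kstar))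
  (gs : finAdelic (↥(maximalRealSubfield L)) L (IsCMField.complexConj L) 2 Jstar)
  -- the representative bookkeeper
  (γ : ↥(rational (↥(maximalRealSubfield L)) L (IsCMField.complexConj L) 3 H))

/-! ## §2 The point computation: `(ιe)_τ ∘ ιs ∘ unif₁ = ι_q ∘ unif_q ∘ (γB)^τ(· ⊕ 0)` on the source cone -/

/-- **The embedded source piece in target-piece coordinates.**  On the negative cone of `J⋆^τ`:
`(ιe)_τ (ιs (unif₁ v)) = ι_q (unif_q ((γB)^τ (v ⊕ 0)))` — ★ `IsEmbedding.map_ptsSymm_mk` (`[v, gs K⋆] ↦ [𝔹(B^τ(v⊕0)), φGS(gs)K]`),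
the γ-move `[𝔹(w), φGS(gs)K] = [𝔹(γ^τ w), gq K]` (★ `ShimuraSet.mk_eq_mk_iff` with `gq⁻¹γ_fφGS(gs) ∈ K`, ★ `ratToU21_smul_negConeToBall`),
and the target `pieces` clause through `gq` (★ `negConeToBall`/`lift_proj`/`unif_smul`).
[cite: Milne2005ShimuraVarieties, Lemma 5.13 p. 57 and Thm. 13.6 p. 118] [cite: Deligne1979ShimuraVarieties, 2.1.2] -/
theorem map_baseChange_emb_map_source_unif
    (hιe : Sstar.IsEmbedding S Jperp B ha hB hτa hτa' Kstar K hK ιe)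
    (hBq : Bq.Hℂ = H.map τ)
    (hιq : letI : Algebra L ℂ := τ.toAlgebra
      ∀ x : Ball, AlgPoints.map (L := ℂ) (ι q) (Bq.unif ((T : Matrix (Fin 3) (Fin 3) ℂ) *ᵥ BallModel.lift x)) =
        AlgPoints.baseChangeEquiv τ (S.M.obj K) ((S.pts K).symm (ShimuraSet.mk L H τ T hT K.1.1 x gq)))
    (hD₁ : D₁.Hℂ = Jstar.map τ)
    (hιs : letI : Algebra L ℂ := τ.toAlgebra
      ∀ (v : Fin 2 → ℂ) (hv : v ∈ negCone (Jstar.map τ)), AlgPoints.map (L := ℂ) ιs (D₁.unif v) =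
        AlgPoints.baseChangeEquiv τ (Sstar.M.obj Kstar) ((Sstar.pts Kstar).symm (ShimuraSetGS.mk L Jstar τ Kstar.1.1 v hv gs)))
    (hγ : gq⁻¹ * (rationalToFinAdelic (↥(maximalRealSubfield L)) L (IsCMField.complexConj L) 3 H γ *
      φGS L Jstar Jperp H B ha hB gs) ∈ K.1.1)
    (v : Fin 2 → ℂ) (hv : v ∈ negCone D₁.Hℂ) :
    AlgPoints.map (L := ℂ) (ιs ≫ (Motives.baseChangeHom τ).map ιe) (D₁.unif v) =
      AlgPoints.map (L := ℂ) (ι q) (Bq.unif (frameEmbNeg τ ((γ : GL (Fin 3) L) * B) v)) := by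
  letI : Algebra L ℂ := τ.toAlgebra
  have hv' : v ∈ negCone (Jstar.map τ) := by rw [← hD₁]; exact hv
  -- the two cone vectors: `w = B^τ(v⊕0)` and `γ^τ w = (γB)^τ(v⊕0)`
  have hw : frameEmbNeg τ B v ∈ negCone (H.map τ) := frameEmbNeg_mem_negCone τ hB hτa hτa' hv'
  have hγB : formCongr ((IsCMField.complexConj L : L ≃ₐ[↥(maximalRealSubfield L)] L) : L →+* L) ((γ : GL (Fin 3) L) * B) (a • H) =
      finSum 2 1 Jstar Jperp := by rw [formCongr_mul_of_mem_rational γ B a]; exact hB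
  have hw' : frameEmbNeg τ ((γ : GL (Fin 3) L) * B) v ∈ negCone (H.map τ) := frameEmbNeg_mem_negCone τ hγB hτa hτa' hv'
  have hγw : ((Matrix.GeneralLinearGroup.map τ ((γ : GL (Fin 3) L)) : GL (Fin 3) ℂ) : Matrix (Fin 3) (Fin 3) ℂ) *ᵥ
      frameEmbNeg τ B v ∈ negCone (H.map τ) := by
    have e : ((Matrix.GeneralLinearGroup.map τ ((γ : GL (Fin 3) L)) : GL (Fin 3) ℂ) : Matrix (Fin 3) (Fin 3) ℂ) *ᵥ
        frameEmbNeg τ B v = frameEmbNeg τ ((γ : GL (Fin 3) L) * B) v := by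
      rw [frameEmbNeg_mul]; rfl
    rw [e]; exact hw'
  -- LHS: through the embedding
  have lhs : AlgPoints.map (L := ℂ) (ιs ≫ (Motives.baseChangeHom τ).map ιe) (D₁.unif v) =
      AlgPoints.baseChangeEquiv τ (S.M.obj K) ((S.pts K).symm (ShimuraSet.mk L H τ T hT K.1.1
        (negConeToBall hT hw) (φGS L Jstar Jperp H B ha hB gs))) := by
    rw [AlgPoints.map_comp_apply, hιs v hv', ← HodgeTheory.baseChangeEquiv_map ιe,
      RecordSystemGS.IsEmbedding.map_ptsSymm_mk Sstar S Jperp B ha hB hτa hτa' hιe v hv' gs]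
  -- the γ-move on the Shimura set
  have hmk : ShimuraSet.mk L H τ T hT K.1.1 (negConeToBall hT hw') gq =
      ShimuraSet.mk L H τ T hT K.1.1 (negConeToBall hT hw) (φGS L Jstar Jperp H B ha hB gs) := by
    rw [ShimuraSet.mk_eq_mk_iff]
    refine ⟨γ, ?_, hγ⟩
    rw [ratToU21_smul_negConeToBall hT γ hw hγw]
    -- proof irrelevance in the membership argument along the vector identity
    have e : ((Matrix.GeneralLinearGroup.map τ ((γ : GL (Fin 3) L)) : GL (Fin 3) ℂ) : Matrix (Fin 3) (Fin 3) ℂ) *ᵥ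
        frameEmbNeg τ B v = frameEmbNeg τ ((γ : GL (Fin 3) L) * B) v := by
      rw [frameEmbNeg_mul]; rfl
    exact negConeToBall_congr' τ hT hγw hw' e
  -- RHS: the target piece through `gq`, at the ball point of `(γB)^τ(v⊕0)`
  have hQ := Q_inv_mulVec_neg_of_mem_negCone hT hw'
  have h2 : ((↑T⁻¹ : Matrix (Fin 3) (Fin 3) ℂ) *ᵥ frameEmbNeg τ ((γ : GL (Fin 3) L) * B) v) 2 ≠ 0 := BallModel.ne_zero_of_Q_neg hQ
  have hlift : (T : Matrix (Fin 3) (Fin 3) ℂ) *ᵥ BallModel.lift (negConeToBall hT hw') =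
      (((↑T⁻¹ : Matrix (Fin 3) (Fin 3) ℂ) *ᵥ frameEmbNeg τ ((γ : GL (Fin 3) L) * B) v) 2)⁻¹ •
        frameEmbNeg τ ((γ : GL (Fin 3) L) * B) v := by
    unfold negConeToBall
    rw [UnitaryBallUniformisationDatum.lift_proj, mulVec_smul, mulVec_mulVec, ← Units.val_mul, mul_inv_cancel,
      Units.val_one, one_mulVec]
  have hwq : frameEmbNeg τ ((γ : GL (Fin 3) L) * B) v ∈ Bq.cone := by
    change _ ∈ negCone Bq.Hℂ; rw [hBq]; exact hw'
  have rhs : AlgPoints.map (L := ℂ) (ι q) (Bq.unif (frameEmbNeg τ ((γ : GL (Fin 3) L) * B) v)) =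
      AlgPoints.baseChangeEquiv τ (S.M.obj K) ((S.pts K).symm (ShimuraSet.mk L H τ T hT K.1.1 (negConeToBall hT hw') gq)) := by
    rw [← hιq, hlift, Bq.unif_smul (inv_ne_zero h2) hwq]
  rw [lhs, rhs, hmk]

/-! ## §3 The four clauses for `M = (√re τa) • τ((γB)·(e₁|e₂))` -/

include hB hτa hτa' in
/-- **(hgram)** `Mᴴ·H^τ·M = D₁.Hℂ`: ★ F3 `conjTranspose_mul_map_mul_eq_map_of_formCongr_eq_finSum` at the frame `γB` of `a·H`
(`formCongr_mul_of_mem_rational`), `(a·H)^τ = τa·H^τ`, and `(√re τa)² = τa`. [cite: BergeronMillsonMoeglin2016Balls, Part 2 §3.1] -/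
theorem source_gram (hD₁ : D₁.Hℂ = Jstar.map τ) :
    ((Real.sqrt (τ a).re : ℂ) • ((((γ : GL (Fin 3) L) * B : GL (Fin 3) L) : Matrix (Fin 3) (Fin 3) L).submatrix id Fin.castSucc).map τ).conjTranspose *
        H.map τ *
        ((Real.sqrt (τ a).re : ℂ) • ((((γ : GL (Fin 3) L) * B : GL (Fin 3) L) : Matrix (Fin 3) (Fin 3) L).submatrix id Fin.castSucc).map τ) =
      D₁.Hℂ := by
  have hγB : formCongr ((IsCMField.complexConj L : L ≃ₐ[↥(maximalRealSubfield L)] L) : L →+* L) ((γ : GL (Fin 3) L) * B) (a • H) =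
      finSum 2 1 Jstar Jperp := by rw [formCongr_mul_of_mem_rational γ B a]; exact hB
  have hg := conjTranspose_mul_map_mul_eq_map_of_formCongr_eq_finSum
    (σ := ((IsCMField.complexConj L : L ≃ₐ[↥(maximalRealSubfield L)] L) : L →+* L)) τ (map_coe_complexConj τ) hγB
  rw [map_smul_eq_smul_map τ a] at hg
  set M₀ := ((((γ : GL (Fin 3) L) * B : GL (Fin 3) L) : Matrix (Fin 3) (Fin 3) L).submatrix id Fin.castSucc).map τ with hM₀
  rw [conjTranspose_smul, Matrix.smul_mul, Matrix.smul_mul, Matrix.mul_smul, smul_smul, hD₁, ← hg, Matrix.mul_smul,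
    Matrix.smul_mul]
  congr 1
  rw [Complex.star_def, Complex.conj_ofReal, sqrt_re_mul_self_eq τ hτa hτa']

include hB hτa in
/-- **(horth)** for the line `W₀ = L ∙ ((γB) e₃)`: `⟪τ∘v, M u⟫_{H^τ} = 0` — ★ F3 `hermForm_map_mulVec_eq_zero_of_forall_hermForm_eq_zero`
fed by the off-diagonal block of `J⋆ ⊕ J⊥` (`formCongr_apply_eq_hermForm`, `finSum_one_apply_last_castSucc`), then the scalars `a`,
`√re τa`. [cite: BergeronMillsonMoeglin2016Balls, Part 2 §3.1] [cite: Liu2021, proof of Thm. 4.15 l. 2207] -/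
theorem source_orthogonal :
    ∀ v ∈ (L ∙ fun i => ((((γ : GL (Fin 3) L) * B : GL (Fin 3) L) : Matrix (Fin 3) (Fin 3) L)) i (Fin.last 2)), ∀ u : Fin 2 → ℂ,
      hermForm (starRingEnd ℂ) (H.map τ) (⇑τ ∘ v)
        (((Real.sqrt (τ a).re : ℂ) • ((((γ : GL (Fin 3) L) * B : GL (Fin 3) L) : Matrix (Fin 3) (Fin 3) L).submatrix id Fin.castSucc).map τ).mulVec u) = 0 := by
  intro v hv u
  set B' : GL (Fin 3) L := (γ : GL (Fin 3) L) * B with hB'def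
  have hγB : formCongr ((IsCMField.complexConj L : L ≃ₐ[↥(maximalRealSubfield L)] L) : L →+* L) B' (a • H) =
      finSum 2 1 Jstar Jperp := by rw [hB'def, formCongr_mul_of_mem_rational γ B a]; exact hB
  obtain ⟨t, rfl⟩ := Submodule.mem_span_singleton.1 hv
  -- the columns of `B'` are `a•H`-orthogonal: last ⟂ castSucc j
  have hcol : ∀ j : Fin 2, hermForm ((IsCMField.complexConj L : L ≃ₐ[↥(maximalRealSubfield L)] L) : L →+* L) (a • H)
      (t • fun i => ((B' : GL (Fin 3) L) : Matrix (Fin 3) (Fin 3) L) i (Fin.last 2))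
      (fun i => ((B' : GL (Fin 3) L) : Matrix (Fin 3) (Fin 3) L) i (Fin.castSucc j)) = 0 := by
    intro j
    rw [hermForm_smul_left', ← formCongr_apply_eq_hermForm, hγB, finSum_one_apply_last_castSucc, mul_zero]
  have h0 := hermForm_map_mulVec_eq_zero_of_forall_hermForm_eq_zero
    (σ := ((IsCMField.complexConj L : L ≃ₐ[↥(maximalRealSubfield L)] L) : L →+* L)) τ (map_coe_complexConj τ) hcol u
  rw [map_smul_eq_smul_map τ a, hermForm_smul_matrix'] at h0
  have hτa0 : τ a ≠ 0 := fun h => by rw [h, Complex.zero_re] at hτa; exact lt_irrefl _ hτa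
  have h0' := (mul_eq_zero.1 h0).resolve_left hτa0
  rw [Matrix.smul_mulVec, hermForm_smul_right', h0', mul_zero]

include hK in
/-- **(hgroup)** every `γ₁ ∈ D₁.Γ` is the restriction along `M` of an element of `Γ_H(gq K gq⁻¹)`: by the source `pieces` group
clause `τ₁(γ₁) = τ(δ)` with `δ ∈ Γ_{J⋆}(gs K⋆ gs⁻¹)`; the witness is `γ·(B(δ ⊕ 1)B⁻¹)·γ⁻¹ = embRational_{γB}(δ)`, rational and with
finite-adelic image `γ_f φGS(δ_f) γ_f⁻¹ ∈ gq K gq⁻¹` (★ `rationalToFinAdelic_embRational_eq_φGS`, `φGS(K⋆) ≤ K`, `gq⁻¹γ_fφGS(gs) ∈ K`);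
the matrix identity is ★ `map_embRational_mulVec_frameEmbNeg` for the frame `γB`. [cite: Kudla1984, §1] [cite: PlatonovRapinchuk1994, §4.1]
[cite: Liu2021, proof of Thm. 4.15 l. 2207] -/
theorem source_group
    (hΓ₁ : D₁.Γ.map (Matrix.GeneralLinearGroup.map (D₁.τ₁ : ↥D₁.E →+* ℂ)) =
      (arithmeticLevel (↥(maximalRealSubfield L)) L (IsCMField.complexConj L) 2 Jstar
        (Kstar.1.1.map (MulAut.conj gs).toMonoidHom)).map (Matrix.GeneralLinearGroup.map τ))
    (hγ : gq⁻¹ * (rationalToFinAdelic (↥(maximalRealSubfield L)) L (IsCMField.complexConj L) 3 H γ *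
      φGS L Jstar Jperp H B ha hB gs) ∈ K.1.1) :
    ∀ γ₁ ∈ D₁.Γ, ∃ γ' ∈ arithmeticLevel (↥(maximalRealSubfield L)) L (IsCMField.complexConj L) 3 H
        (K.1.1.map (MulAut.conj gq).toMonoidHom),
      (γ' : Matrix (Fin 3) (Fin 3) L).map τ *
          ((Real.sqrt (τ a).re : ℂ) • ((((γ : GL (Fin 3) L) * B : GL (Fin 3) L) : Matrix (Fin 3) (Fin 3) L).submatrix id Fin.castSucc).map τ) =
        ((Real.sqrt (τ a).re : ℂ) • ((((γ : GL (Fin 3) L) * B : GL (Fin 3) L) : Matrix (Fin 3) (Fin 3) L).submatrix id Fin.castSucc).map τ) *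
          ((γ₁ : Matrix (Fin 2) (Fin 2) ↥D₁.E)).map D₁.E.subtype := by
  intro γ₁ hγ₁
  -- the rational matrix `δ` of `γ₁`
  have hmem : Matrix.GeneralLinearGroup.map (D₁.τ₁ : ↥D₁.E →+* ℂ) γ₁ ∈
      (arithmeticLevel (↥(maximalRealSubfield L)) L (IsCMField.complexConj L) 2 Jstar
        (Kstar.1.1.map (MulAut.conj gs).toMonoidHom)).map (Matrix.GeneralLinearGroup.map τ) := by
    rw [← hΓ₁]; exact Subgroup.mem_map_of_mem _ hγ₁
  obtain ⟨δ, hδ, hδγ₁⟩ := Subgroup.mem_map.1 hmem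
  obtain ⟨hδr, hδK⟩ := mem_arithmeticLevel_iff.1 hδ
  set δr : ↥(rational (↥(maximalRealSubfield L)) L (IsCMField.complexConj L) 2 Jstar) := ⟨δ, hδr⟩ with hδrdef
  -- the frame `B' = γB` and the witness `embRational_{B'} δ`
  set B' : GL (Fin 3) L := (γ : GL (Fin 3) L) * B with hB'def
  have hγB : formCongr ((IsCMField.complexConj L : L ≃ₐ[↥(maximalRealSubfield L)] L) : L →+* L) B' (a • H) =
      finSum 2 1 Jstar Jperp := by rw [hB'def, formCongr_mul_of_mem_rational γ B a]; exact hB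
  set γ' := embRational (↥(maximalRealSubfield L)) L (IsCMField.complexConj L) 2 1 Jstar Jperp H B' ha hγB δr with hγ'def
  refine ⟨(γ' : GL (Fin 3) L), ?_, ?_⟩
  · -- membership in `Γ_H(gq K gq⁻¹)`
    refine mem_arithmeticLevel_iff.2 ⟨γ'.2, ?_⟩
    have hcoe : (⟨((γ' : ↥(rational (↥(maximalRealSubfield L)) L (IsCMField.complexConj L) 3 H)) : GL (Fin 3) L), γ'.2⟩ :
        ↥(rational (↥(maximalRealSubfield L)) L (IsCMField.complexConj L) 3 H)) = γ' := Subtype.ext rfl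
    rw [hcoe]
    -- `γ' = γ · embRational_B δ · γ⁻¹` in `U(H)(L⁺)`
    have hγ'eq : γ' = γ * embRational (↥(maximalRealSubfield L)) L (IsCMField.complexConj L) 2 1 Jstar Jperp H B ha hB δr * γ⁻¹ := by
      apply Subtype.ext
      rw [hγ'def, coe_embRational]
      change B' * _ * B'⁻¹ = (γ : GL (Fin 3) L) *
        ((embRational (↥(maximalRealSubfield L)) L (IsCMField.complexConj L) 2 1 Jstar Jperp H B ha hB δr :
          ↥(rational (↥(maximalRealSubfield L)) L (IsCMField.complexConj L) 3 H)) : GL (Fin 3) L) * ((γ : GL (Fin 3) L))⁻¹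
      rw [coe_embRational, hB'def, _root_.mul_inv_rev]
      simp only [mul_assoc]
    rw [hγ'eq, map_mul, map_mul, map_inv, rationalToFinAdelic_embRational_eq_φGS]
    -- `δ_f = gs k gs⁻¹` with `k ∈ K⋆`
    rw [Subgroup.mem_map_equiv, MulAut.conj_symm_apply] at hδK
    have hk : φGS L Jstar Jperp H B ha hB (gs⁻¹ * rationalToFinAdelic (↥(maximalRealSubfield L)) L (IsCMField.complexConj L) 2 Jstar δr * gs) ∈ K.1.1 :=
      hK (Subgroup.mem_map_of_mem _ hδK)
    rw [Subgroup.mem_map_equiv, MulAut.conj_symm_apply]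
    -- group bookkeeping
    set k₀ := gq⁻¹ * (rationalToFinAdelic (↥(maximalRealSubfield L)) L (IsCMField.complexConj L) 3 H γ *
      φGS L Jstar Jperp H B ha hB gs) with hk₀
    have e : gq⁻¹ * (rationalToFinAdelic (↥(maximalRealSubfield L)) L (IsCMField.complexConj L) 3 H γ *
        φGS L Jstar Jperp H B ha hB (rationalToFinAdelic (↥(maximalRealSubfield L)) L (IsCMField.complexConj L) 2 Jstar δr) *
        (rationalToFinAdelic (↥(maximalRealSubfield L)) L (IsCMField.complexConj L) 3 H γ)⁻¹) * gq =
        k₀ * φGS L Jstar Jperp H B ha hB (gs⁻¹ * rationalToFinAdelic (↥(maximalRealSubfield L)) L (IsCMField.complexConj L) 2 Jstar δr * gs) * k₀⁻¹ := by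
      rw [hk₀, map_mul, map_mul, map_inv]; group
    rw [e]
    exact K.1.1.mul_mem (K.1.1.mul_mem hγ hk) (K.1.1.inv_mem hγ)
  · -- the matrix identity, from the vector identity ★ `map_embRational_mulVec_frameEmbNeg` for the frame `B'`
    have hvec := map_embRational_mulVec_frameEmbNeg (τ := τ) H Jstar Jperp B' ha hγB δr
    have hmat : (((γ' : ↥(rational (↥(maximalRealSubfield L)) L (IsCMField.complexConj L) 3 H)) : GL (Fin 3) L) : Matrix (Fin 3) (Fin 3) L).map τ *
        (((B' : Matrix (Fin 3) (Fin 3) L).submatrix id Fin.castSucc).map τ) =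
        (((B' : Matrix (Fin 3) (Fin 3) L).submatrix id Fin.castSucc).map τ) * (δ : Matrix (Fin 2) (Fin 2) L).map τ := by
      refine Matrix.toLin'.injective (LinearMap.ext fun x => ?_)
      rw [Matrix.toLin'_apply, Matrix.toLin'_apply, ← mulVec_mulVec, ← mulVec_mulVec, submatrix_map_mulVec_eq_frameEmbNeg,
        submatrix_map_mulVec_eq_frameEmbNeg]
      exact hvec x
    have hδ' : (δ : Matrix (Fin 2) (Fin 2) L).map τ = ((γ₁ : Matrix (Fin 2) (Fin 2) ↥D₁.E)).map D₁.E.subtype := by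
      have := congrArg (fun g : GL (Fin 2) ℂ => (g : Matrix (Fin 2) (Fin 2) ℂ)) hδγ₁
      exact this
    rw [Matrix.mul_smul, Matrix.smul_mul, hmat, hδ']

/-- **(hunif)** `φ(ℂ)(unif₁ v) = unif_q(M v)` on the cone, for ANY `φ : Y ⟶ X q` over `(ιe)_τ ∘ ιs` (`φ ≫ ι q = ιs ≫ (ιe)_τ`): §2 computes
both sides after `ι q`, and `ι q` — a leg of a colimit cofan, hence an open immersion (★ `Morphisms.isOpenImmersion_of_isColimit_cofan`),
hence a monomorphism — is injective on `ℂ`-points. [cite: Milne2005ShimuraVarieties, Thm. 13.6 p. 118] [cite: GortzWedhorn2020, §(3.5) Example 3.11] -/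
theorem source_unif_comp (hcol : IsColimit (Cofan.mk ((Motives.baseChangeHom τ).obj (S.M.obj K)) ι))
    (hιe : Sstar.IsEmbedding S Jperp B ha hB hτa hτa' Kstar K hK ιe)
    (hBq : Bq.Hℂ = H.map τ)
    (hιq : letI : Algebra L ℂ := τ.toAlgebra
      ∀ x : Ball, AlgPoints.map (L := ℂ) (ι q) (Bq.unif ((T : Matrix (Fin 3) (Fin 3) ℂ) *ᵥ BallModel.lift x)) =
        AlgPoints.baseChangeEquiv τ (S.M.obj K) ((S.pts K).symm (ShimuraSet.mk L H τ T hT K.1.1 x gq)))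
    (hD₁ : D₁.Hℂ = Jstar.map τ)
    (hιs : letI : Algebra L ℂ := τ.toAlgebra
      ∀ (v : Fin 2 → ℂ) (hv : v ∈ negCone (Jstar.map τ)), AlgPoints.map (L := ℂ) ιs (D₁.unif v) =
        AlgPoints.baseChangeEquiv τ (Sstar.M.obj Kstar) ((Sstar.pts Kstar).symm (ShimuraSetGS.mk L Jstar τ Kstar.1.1 v hv gs)))
    (hγ : gq⁻¹ * (rationalToFinAdelic (↥(maximalRealSubfield L)) L (IsCMField.complexConj L) 3 H γ *
      φGS L Jstar Jperp H B ha hB gs) ∈ K.1.1)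
    {φ : Y ⟶ X q} (hφ : φ ≫ ι q = ιs ≫ (Motives.baseChangeHom τ).map ιe) :
    ∀ v ∈ negCone D₁.Hℂ, AlgPoints.map (L := ℂ) φ (D₁.unif v) =
      Bq.unif (((Real.sqrt (τ a).re : ℂ) • ((((γ : GL (Fin 3) L) * B : GL (Fin 3) L) : Matrix (Fin 3) (Fin 3) L).submatrix id Fin.castSucc).map τ).mulVec v) := by
  intro v hv
  -- `ι q` is a monomorphism
  obtain ⟨hcl⟩ := Literature.AlgebraicGeometry.Morphisms.isColimit_cofan_left hcol
  haveI : IsOpenImmersion (ι q).left := Literature.AlgebraicGeometry.Morphisms.isOpenImmersion_of_isColimit_cofan hcl q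
  haveI : Mono (ι q) := Over.mono_of_mono_left _
  -- compare after `ι q`
  have key := map_baseChange_emb_map_source_unif Sstar S Jperp B ha hB hτa hτa' hK q Bq gq D₁ ιs gs γ hιe hBq hιq hD₁ hιs hγ v hv
  have hv' : v ∈ negCone (Jstar.map τ) := by rw [← hD₁]; exact hv
  have hγB : formCongr ((IsCMField.complexConj L : L ≃ₐ[↥(maximalRealSubfield L)] L) : L →+* L) ((γ : GL (Fin 3) L) * B) (a • H) =
      finSum 2 1 Jstar Jperp := by rw [formCongr_mul_of_mem_rational γ B a]; exact hB
  have hw' : frameEmbNeg τ ((γ : GL (Fin 3) L) * B) v ∈ Bq.cone := by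
    change _ ∈ negCone Bq.Hℂ; rw [hBq]; exact frameEmbNeg_mem_negCone τ hγB hτa hτa' hv'
  have hr : (Real.sqrt (τ a).re : ℂ) ≠ 0 := by
    rw [Ne, Complex.ofReal_eq_zero]; exact (Real.sqrt_pos.2 hτa).ne'
  have hMv : ((Real.sqrt (τ a).re : ℂ) • ((((γ : GL (Fin 3) L) * B : GL (Fin 3) L) : Matrix (Fin 3) (Fin 3) L).submatrix id Fin.castSucc).map τ).mulVec v =
      (Real.sqrt (τ a).re : ℂ) • frameEmbNeg τ ((γ : GL (Fin 3) L) * B) v := by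
    rw [Matrix.smul_mulVec, submatrix_map_mulVec_eq_frameEmbNeg]
  rw [hMv, Bq.unif_smul hr hw']
  apply (cancel_mono (ι q)).1
  change AlgPoints.map (L := ℂ) (ι q) (AlgPoints.map (L := ℂ) φ (D₁.unif v)) =
    AlgPoints.map (L := ℂ) (ι q) (Bq.unif (frameEmbNeg τ ((γ : GL (Fin 3) L) * B) v))
  rw [← AlgPoints.map_comp_apply, hφ, key]

/-! ## §4 The factorisation and the bundle -/

/-- **`φ : Y ⟶ X q` exists**: the composite `ιs ≫ (ιe)_τ : Y ⟶ (M_K)_τ` out of the (geometrically irreducible, hence preconnected)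
source piece factors through the leg `ι q` — one of its points (the image of `unif₁ v₀` for a negative `v₀`, which exists by
`signature_τ₁`) lands in the image of `ι q` by §2; ★ (7-fac) `Morphisms.exists_fac_of_isColimit_cofan_of_mem`.
[cite: GortzWedhorn2020, Lemma 1.19 (1) (§(1.5)) with §(3.5) Example 3.11] [cite: Milne2005ShimuraVarieties, Thm. 13.6 p. 118] -/
theorem exists_fac_source (hcol : IsColimit (Cofan.mk ((Motives.baseChangeHom τ).obj (S.M.obj K)) ι))
    (hιe : Sstar.IsEmbedding S Jperp B ha hB hτa hτa' Kstar K hK ιe)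
    (hBq : Bq.Hℂ = H.map τ)
    (hιq : letI : Algebra L ℂ := τ.toAlgebra
      ∀ x : Ball, AlgPoints.map (L := ℂ) (ι q) (Bq.unif ((T : Matrix (Fin 3) (Fin 3) ℂ) *ᵥ BallModel.lift x)) =
        AlgPoints.baseChangeEquiv τ (S.M.obj K) ((S.pts K).symm (ShimuraSet.mk L H τ T hT K.1.1 x gq)))
    (hD₁ : D₁.Hℂ = Jstar.map τ)
    (hιs : letI : Algebra L ℂ := τ.toAlgebra
      ∀ (v : Fin 2 → ℂ) (hv : v ∈ negCone (Jstar.map τ)), AlgPoints.map (L := ℂ) ιs (D₁.unif v) =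
        AlgPoints.baseChangeEquiv τ (Sstar.M.obj Kstar) ((Sstar.pts Kstar).symm (ShimuraSetGS.mk L Jstar τ Kstar.1.1 v hv gs)))
    (hγ : gq⁻¹ * (rationalToFinAdelic (↥(maximalRealSubfield L)) L (IsCMField.complexConj L) 3 H γ *
      φGS L Jstar Jperp H B ha hB gs) ∈ K.1.1) :
    ∃ φ : Y ⟶ X q, φ ≫ ι q = ιs ≫ (Motives.baseChangeHom τ).map ιe := by
  -- `Y` is preconnected
  haveI : PreconnectedSpace Y.left :=
    haveI := D₁.isSmoothProjective.geometricallyIrreducible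
    haveI := GeometricallyIrreducible.irreducibleSpace_of_subsingleton Y.hom
    inferInstance
  -- a negative vector of `D₁.Hℂ` (last column of a Sylvester frame)
  obtain ⟨T₁, hT₁⟩ := D₁.signature_τ₁
  have hv₀ : (fun i => (T₁ : Matrix (Fin 2) (Fin 2) ℂ) i (Fin.last 1)) ∈ negCone D₁.Hℂ := by
    change (hermForm (starRingEnd ℂ) D₁.Hℂ _ _).re < 0
    rw [← conjTranspose_mul_mul_apply, show D₁.Hℂ = D₁.H.map D₁.E.subtype from rfl, hT₁]
    simp [signatureMatrix]
  -- its image lands in the range of `ι q`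
  have key := map_baseChange_emb_map_source_unif Sstar S Jperp B ha hB hτa hτa' hK q Bq gq D₁ ιs gs γ hιe hBq hιq hD₁ hιs hγ _ hv₀
  have hw : (ιs ≫ (Motives.baseChangeHom τ).map ιe).left (D₁.unif fun i => (T₁ : Matrix (Fin 2) (Fin 2) ℂ) i (Fin.last 1)).pt ∈
      Set.range (ι q).left := by
    refine ⟨(Bq.unif (frameEmbNeg τ ((γ : GL (Fin 3) L) * B) fun i => (T₁ : Matrix (Fin 2) (Fin 2) ℂ) i (Fin.last 1))).pt, ?_⟩
    have h1 := congrArg AlgPoints.pt key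
    rw [AlgPoints.pt_map, AlgPoints.pt_map] at h1
    exact h1.symm
  exact Literature.AlgebraicGeometry.Morphisms.exists_fac_of_isColimit_cofan_of_mem hcol _ _ q hw

/-- **(7-src) THE BUNDLE.**  For the GS source read through one source piece `(Y, D₁, ιs, gs)`, one target piece `(X q, Bq, ι q, gq)` of
a colimit cofan of `(M_K)_τ`, an embedding `ιe` (u2) and a representative bookkeeper `γ` (`gq⁻¹γ_fφGS(gs) ∈ K`): there is
`φ : Y ⟶ X q` over `(ιe)_τ ∘ ιs` such that `(Y, D₁, φ, M)`, `M = (√re τa) • τ((γB)·(e₁|e₂))`, satisfies the four `L`-clauses of ★ GS-7c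
`MR92Prop6Source.exists_line_detecting_of_forall` / ★ (7c-rec) `HComp.RecordSystem.exists_pieces_detectingLine` at
`Γ′ = Γ_H(gq K gq⁻¹)`, for the line `W₀ = L ∙ ((γB) e₃)`. [cite: Liu2021, proof of Thm. 4.15, l. 2207 and l. 2212]
[cite: Milne2005ShimuraVarieties, Thm. 13.6 p. 118 and Lemma 5.13 p. 57] [cite: BergeronMillsonMoeglin2016Balls, Part 2 §§3.1–3.3] -/
theorem exists_fac_and_fourClauses (hcol : IsColimit (Cofan.mk ((Motives.baseChangeHom τ).obj (S.M.obj K)) ι))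
    (hιe : Sstar.IsEmbedding S Jperp B ha hB hτa hτa' Kstar K hK ιe)
    (hBq : Bq.Hℂ = H.map τ)
    (hιq : letI : Algebra L ℂ := τ.toAlgebra
      ∀ x : Ball, AlgPoints.map (L := ℂ) (ι q) (Bq.unif ((T : Matrix (Fin 3) (Fin 3) ℂ) *ᵥ BallModel.lift x)) =
        AlgPoints.baseChangeEquiv τ (S.M.obj K) ((S.pts K).symm (ShimuraSet.mk L H τ T hT K.1.1 x gq)))
    (hD₁ : D₁.Hℂ = Jstar.map τ)
    (hΓ₁ : D₁.Γ.map (Matrix.GeneralLinearGroup.map (D₁.τ₁ : ↥D₁.E →+* ℂ)) =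
      (arithmeticLevel (↥(maximalRealSubfield L)) L (IsCMField.complexConj L) 2 Jstar
        (Kstar.1.1.map (MulAut.conj gs).toMonoidHom)).map (Matrix.GeneralLinearGroup.map τ))
    (hιs : letI : Algebra L ℂ := τ.toAlgebra
      ∀ (v : Fin 2 → ℂ) (hv : v ∈ negCone (Jstar.map τ)), AlgPoints.map (L := ℂ) ιs (D₁.unif v) =
        AlgPoints.baseChangeEquiv τ (Sstar.M.obj Kstar) ((Sstar.pts Kstar).symm (ShimuraSetGS.mk L Jstar τ Kstar.1.1 v hv gs)))
    (hγ : gq⁻¹ * (rationalToFinAdelic (↥(maximalRealSubfield L)) L (IsCMField.complexConj L) 3 H γ *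
      φGS L Jstar Jperp H B ha hB gs) ∈ K.1.1) :
    ∃ φ : Y ⟶ X q, φ ≫ ι q = ιs ≫ (Motives.baseChangeHom τ).map ιe ∧
      let M : Matrix (Fin 3) (Fin 2) ℂ :=
        (Real.sqrt (τ a).re : ℂ) • ((((γ : GL (Fin 3) L) * B : GL (Fin 3) L) : Matrix (Fin 3) (Fin 3) L).submatrix id Fin.castSucc).map τ
      M.conjTranspose * H.map τ * M = D₁.Hℂ ∧
      (∀ v ∈ (L ∙ fun i => ((((γ : GL (Fin 3) L) * B : GL (Fin 3) L) : Matrix (Fin 3) (Fin 3) L)) i (Fin.last 2)), ∀ u : Fin 2 → ℂ,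
        hermForm (starRingEnd ℂ) (H.map τ) (⇑τ ∘ v) (M.mulVec u) = 0) ∧
      (∀ γ₁ ∈ D₁.Γ, ∃ γ' ∈ arithmeticLevel (↥(maximalRealSubfield L)) L (IsCMField.complexConj L) 3 H
          (K.1.1.map (MulAut.conj gq).toMonoidHom),
        (γ' : Matrix (Fin 3) (Fin 3) L).map τ * M = M * ((γ₁ : Matrix (Fin 2) (Fin 2) ↥D₁.E)).map D₁.E.subtype) ∧
      (∀ v ∈ negCone D₁.Hℂ, AlgPoints.map (L := ℂ) φ (D₁.unif v) = Bq.unif (M.mulVec v)) := by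
  obtain ⟨φ, hφ⟩ := exists_fac_source Sstar S Jperp B ha hB hτa hτa' hK q Bq gq D₁ ιs gs γ hcol hιe hBq hιq hD₁ hιs hγ
  exact ⟨φ, hφ, source_gram Jperp B hB hτa hτa' D₁ γ hD₁, source_orthogonal Jperp B hB hτa γ,
    source_group Jperp B ha hB hK gq D₁ gs γ hΓ₁ hγ,
    source_unif_comp Sstar S Jperp B ha hB hτa hτa' hK q Bq gq D₁ ιs gs γ hcol hιe hBq hιq hD₁ hιs hγ hφ⟩

/-! ## §5 The identity pieces: the bookkeeper `γ = γ₁ · embRational(γ⋆)⁻¹` and the line `L ∙ ((γ₁B) e₃)` -/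

include hK in
/-- **The bookkeeper at a pair of pieces with RATIONAL representatives up to the levels**: if `gq⁻¹γ₁_f ∈ K` (e.g. `q` the identity class
of `Ξ_K`, `γ₁` the rational part of its representative) and `gs⁻¹γ⋆_f ∈ K⋆` (the same on the curve), then
`γ := γ₁ · embRational_B(γ⋆)⁻¹` satisfies `gq⁻¹ · γ_f · φGS(gs) ∈ K` (`φGS(γ⋆_f) = embRational_B(γ⋆)_f`, `φGS(K⋆) ≤ K`).
[cite: Milne2005ShimuraVarieties, Lemma 5.13 p. 57] [cite: PlatonovRapinchuk1994, §5.1] -/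
theorem bookkeeper_of_rational_reps
    (γ₁ : ↥(rational (↥(maximalRealSubfield L)) L (IsCMField.complexConj L) 3 H))
    (hγ₁ : gq⁻¹ * rationalToFinAdelic (↥(maximalRealSubfield L)) L (IsCMField.complexConj L) 3 H γ₁ ∈ K.1.1)
    (γs : ↥(rational (↥(maximalRealSubfield L)) L (IsCMField.complexConj L) 2 Jstar))
    (hγs : gs⁻¹ * rationalToFinAdelic (↥(maximalRealSubfield L)) L (IsCMField.complexConj L) 2 Jstar γs ∈ Kstar.1.1) :
    gq⁻¹ * (rationalToFinAdelic (↥(maximalRealSubfield L)) L (IsCMField.complexConj L) 3 H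
        (γ₁ * (embRational (↥(maximalRealSubfield L)) L (IsCMField.complexConj L) 2 1 Jstar Jperp H B ha hB γs)⁻¹) *
      φGS L Jstar Jperp H B ha hB gs) ∈ K.1.1 := by
  have hk : φGS L Jstar Jperp H B ha hB (gs⁻¹ * rationalToFinAdelic (↥(maximalRealSubfield L)) L (IsCMField.complexConj L) 2 Jstar γs) ∈ K.1.1 :=
    hK (Subgroup.mem_map_of_mem _ hγs)
  rw [map_mul, map_inv] at hk
  rw [map_mul, map_inv, rationalToFinAdelic_embRational_eq_φGS]
  have e : gq⁻¹ * (rationalToFinAdelic (↥(maximalRealSubfield L)) L (IsCMField.complexConj L) 3 H γ₁ *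
      (φGS L Jstar Jperp H B ha hB (rationalToFinAdelic (↥(maximalRealSubfield L)) L (IsCMField.complexConj L) 2 Jstar γs))⁻¹ *
      φGS L Jstar Jperp H B ha hB gs) =
      (gq⁻¹ * rationalToFinAdelic (↥(maximalRealSubfield L)) L (IsCMField.complexConj L) 3 H γ₁) *
        ((φGS L Jstar Jperp H B ha hB gs)⁻¹ *
          φGS L Jstar Jperp H B ha hB (rationalToFinAdelic (↥(maximalRealSubfield L)) L (IsCMField.complexConj L) 2 Jstar γs))⁻¹ := by
    group
  rw [e]
  exact K.1.1.mul_mem hγ₁ (K.1.1.inv_mem hk)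

/-- **The line at the identity pieces does not see `γ⋆`**: `(γ₁ · embRational_B(γ⋆)⁻¹ · B) e₃ = (γ₁ · B) e₃`, because
`embRational_B(γ⋆)⁻¹ · B = B · (γ⋆⁻¹ ⊕ 1)` and `(X ⊕ 1) e₃ = e₃`.  So the detecting line of §4 is `L ∙ ((γ₁B) e₃)`; a consumer
holding a frame `B₀` of a PRESCRIBED line `W₀ = L ∙ (B₀ e₃)` (★ F3 on III-8′'s line) uses `B := γ₁⁻¹B₀`
(`formCongr_mul_of_mem_rational`) and reads `W₀` back. [cite: Kudla1984, §1] [cite: BergeronMillsonMoeglin2016Balls, Part 2 §3.1] -/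
theorem lastCol_bookkeeper_mul_eq
    (γ₁ : ↥(rational (↥(maximalRealSubfield L)) L (IsCMField.complexConj L) 3 H))
    (γs : ↥(rational (↥(maximalRealSubfield L)) L (IsCMField.complexConj L) 2 Jstar)) :
    (fun i => ((((γ₁ * (embRational (↥(maximalRealSubfield L)) L (IsCMField.complexConj L) 2 1 Jstar Jperp H B ha hB γs)⁻¹ :
        ↥(rational (↥(maximalRealSubfield L)) L (IsCMField.complexConj L) 3 H)) : GL (Fin 3) L) * B : GL (Fin 3) L) :
          Matrix (Fin 3) (Fin 3) L) i (Fin.last 2)) =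
      fun i => ((((γ₁ : GL (Fin 3) L) * B : GL (Fin 3) L) : Matrix (Fin 3) (Fin 3) L)) i (Fin.last 2) := by
  -- `γ₁ (B (γ⋆⊕1) B⁻¹)⁻¹ B = γ₁ B (γ⋆⊕1)⁻¹`
  have hGL : ((γ₁ * (embRational (↥(maximalRealSubfield L)) L (IsCMField.complexConj L) 2 1 Jstar Jperp H B ha hB γs)⁻¹ :
        ↥(rational (↥(maximalRealSubfield L)) L (IsCMField.complexConj L) 3 H)) : GL (Fin 3) L) * B =
      (γ₁ : GL (Fin 3) L) * B *
        ((rationalBlockDiag (↥(maximalRealSubfield L)) L (IsCMField.complexConj L) 2 1 Jstar Jperp (γs, 1) :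
          ↥(rational (↥(maximalRealSubfield L)) L (IsCMField.complexConj L) 3 (finSum 2 1 Jstar Jperp))) : GL (Fin 3) L)⁻¹ := by
    rw [Subgroup.coe_mul, Subgroup.coe_inv, coe_embRational]
    group
  funext i
  rw [hGL, Units.val_mul, Matrix.mul_apply]
  -- the last column of `(γ⋆ ⊕ 1)⁻¹ = γ⋆⁻¹ ⊕ 1` is `e₃`
  have hinv : ((rationalBlockDiag (↥(maximalRealSubfield L)) L (IsCMField.complexConj L) 2 1 Jstar Jperp (γs, 1) :
          ↥(rational (↥(maximalRealSubfield L)) L (IsCMField.complexConj L) 3 (finSum 2 1 Jstar Jperp))) : GL (Fin 3) L)⁻¹ =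
      ((rationalBlockDiag (↥(maximalRealSubfield L)) L (IsCMField.complexConj L) 2 1 Jstar Jperp (γs⁻¹, 1) :
          ↥(rational (↥(maximalRealSubfield L)) L (IsCMField.complexConj L) 3 (finSum 2 1 Jstar Jperp))) : GL (Fin 3) L) := by
    rw [← Subgroup.coe_inv, ← map_inv, Prod.inv_mk, inv_one]
  rw [hinv]
  have hcol : ∀ j : Fin 3, (((rationalBlockDiag (↥(maximalRealSubfield L)) L (IsCMField.complexConj L) 2 1 Jstar Jperp (γs⁻¹, 1) :
          ↥(rational (↥(maximalRealSubfield L)) L (IsCMField.complexConj L) 3 (finSum 2 1 Jstar Jperp))) : GL (Fin 3) L) :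
            Matrix (Fin 3) (Fin 3) L) j (Fin.last 2) = if j = Fin.last 2 then 1 else 0 := by
    intro j
    change finSum 2 1 (((γs⁻¹ : ↥(rational (↥(maximalRealSubfield L)) L (IsCMField.complexConj L) 2 Jstar)) : GL (Fin 2) L) :
        Matrix (Fin 2) (Fin 2) L)
      ((((1 : ↥(rational (↥(maximalRealSubfield L)) L (IsCMField.complexConj L) 1 Jperp)) : GL (Fin 1) L) : Matrix (Fin 1) (Fin 1) L))
        j (Fin.last 2) = _
    rw [show (((1 : ↥(rational (↥(maximalRealSubfield L)) L (IsCMField.complexConj L) 1 Jperp)) : GL (Fin 1) L) : Matrix (Fin 1) (Fin 1) L) = 1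
      from rfl]
    refine Fin.lastCases ?_ (fun j' => ?_) j
    · rw [if_pos rfl]
      exact finSum_one_apply_last_last _ _
    · rw [if_neg (Fin.castSucc_lt_last j').ne, finSum_one_apply_castSucc_last]
  simp only [hcol, mul_ite, mul_one, mul_zero, Finset.sum_ite_eq', Finset.mem_univ, if_true]

/-! ## §6 Consumer shape: the detecting clause of ★ (7c-rec) / ★ GS-7c applied to the GS source -/

/-- **The GS source piece DETECTS the class.**  If a class `c ∈ H¹(X_q(ℂ); ℂ)` is detected by every uniformised special curve
satisfying the four `L`-clauses at `(H, τ, Γ_H(gq K gq⁻¹), W₀)` with `W₀ = L ∙ ((γB) e₃)` — VERBATIM the conclusion of ★ (7c-rec)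
`HComp.RecordSystem.exists_pieces_detectingLine` / ★ GS-7c `MR92Prop6Source.exists_line_detecting_of_forall` for that line — then its
pull-back to the source piece `Y` along `φ` (over `(ιe)_τ ∘ ιs`) is non-zero.  This is the (7-src) step of the GS-7 clause-(1) closer.
[cite: Liu2021, proof of Thm. 4.15, l. 2212 and footnote 9; l. 2207] [cite: MurtyRamakrishnan1992, Prop. 6 (locator unverified)] -/
theorem exists_fac_pullback_ne_zero (hcol : IsColimit (Cofan.mk ((Motives.baseChangeHom τ).obj (S.M.obj K)) ι))
    (hιe : Sstar.IsEmbedding S Jperp B ha hB hτa hτa' Kstar K hK ιe)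
    (hBq : Bq.Hℂ = H.map τ)
    (hιq : letI : Algebra L ℂ := τ.toAlgebra
      ∀ x : Ball, AlgPoints.map (L := ℂ) (ι q) (Bq.unif ((T : Matrix (Fin 3) (Fin 3) ℂ) *ᵥ BallModel.lift x)) =
        AlgPoints.baseChangeEquiv τ (S.M.obj K) ((S.pts K).symm (ShimuraSet.mk L H τ T hT K.1.1 x gq)))
    (hD₁ : D₁.Hℂ = Jstar.map τ)
    (hΓ₁ : D₁.Γ.map (Matrix.GeneralLinearGroup.map (D₁.τ₁ : ↥D₁.E →+* ℂ)) =
      (arithmeticLevel (↥(maximalRealSubfield L)) L (IsCMField.complexConj L) 2 Jstar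
        (Kstar.1.1.map (MulAut.conj gs).toMonoidHom)).map (Matrix.GeneralLinearGroup.map τ))
    (hιs : letI : Algebra L ℂ := τ.toAlgebra
      ∀ (v : Fin 2 → ℂ) (hv : v ∈ negCone (Jstar.map τ)), AlgPoints.map (L := ℂ) ιs (D₁.unif v) =
        AlgPoints.baseChangeEquiv τ (Sstar.M.obj Kstar) ((Sstar.pts Kstar).symm (ShimuraSetGS.mk L Jstar τ Kstar.1.1 v hv gs)))
    (hγ : gq⁻¹ * (rationalToFinAdelic (↥(maximalRealSubfield L)) L (IsCMField.complexConj L) 3 H γ *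
      φGS L Jstar Jperp H B ha hB gs) ∈ K.1.1)
    (c : HodgeTheory.complexBetti (X q) 1)
    (hdet : ∀ (Y' : SchemeOver ℂ) (D' : UnitaryBallUniformisationDatum 1 Y') (φ' : Y' ⟶ X q) (M : Matrix (Fin 3) (Fin 2) ℂ),
      M.conjTranspose * H.map τ * M = D'.Hℂ →
      (∀ v ∈ (L ∙ fun i => ((((γ : GL (Fin 3) L) * B : GL (Fin 3) L) : Matrix (Fin 3) (Fin 3) L)) i (Fin.last 2)), ∀ u : Fin 2 → ℂ,
        hermForm (starRingEnd ℂ) (H.map τ) (⇑τ ∘ v) (M.mulVec u) = 0) →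
      (∀ γ₁ ∈ D'.Γ, ∃ γ' ∈ arithmeticLevel (↥(maximalRealSubfield L)) L (IsCMField.complexConj L) 3 H
          (K.1.1.map (MulAut.conj gq).toMonoidHom),
        (γ' : Matrix (Fin 3) (Fin 3) L).map τ * M = M * ((γ₁ : Matrix (Fin 2) (Fin 2) ↥D'.E)).map D'.E.subtype) →
      (∀ v ∈ negCone D'.Hℂ, AlgPoints.map (L := ℂ) φ' (D'.unif v) = Bq.unif (M.mulVec v)) →
        Literature.AlgebraicTopology.SingularHomology.singularCohomology.map ℂ ℂ (AlgPoints.mapContinuous (L := ℂ) φ') 1 c ≠ 0) :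
    ∃ φ : Y ⟶ X q, φ ≫ ι q = ιs ≫ (Motives.baseChangeHom τ).map ιe ∧
      Literature.AlgebraicTopology.SingularHomology.singularCohomology.map ℂ ℂ (AlgPoints.mapContinuous (L := ℂ) φ) 1 c ≠ 0 := by
  obtain ⟨φ, hφ, hgram, horth, hgroup, hunif⟩ :=
    exists_fac_and_fourClauses Sstar S Jperp B ha hB hτa hτa' hK q Bq gq D₁ ιs gs γ hcol hιe hBq hιq hD₁ hΓ₁ hιs hγ
  exact ⟨φ, hφ, hdet Y D₁ φ _ hgram horth hgroup hunif⟩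

/-! ## §7 The closer's entry point at the identity pieces: rational representatives and a PRESCRIBED frame `B₀ = γ₁·B` -/

include hK in
/-- **(7-src) at a pair of pieces with rational representatives, for a prescribed frame.**  Let `γ₁ ∈ U(H)(L⁺)` with `gq⁻¹γ₁_f ∈ K`
(★ `UnitaryGroup.exists_rational_smul_rep_mem hg 1` at the identity class of `Ξ_K`, inverted) and `γ⋆ ∈ U(J⋆)(L⁺)` with
`gs⁻¹γ⋆_f ∈ K⋆` (the same on the curve), and let the embedding frame `B` be the translate `γ₁⁻¹·B₀` of a frame `B₀` (`γ₁·B = B₀`;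
`hB` from `hB₀` by `formCongr_mul_of_mem_rational`).  If a class `c ∈ H¹(X_q(ℂ); ℂ)` is detected by every uniformised special curve
satisfying the four `L`-clauses at `(H, τ, Γ_H(gq K gq⁻¹), W₀)` for the PRESCRIBED line `W₀ = L ∙ (B₀ e₃)` — the conclusion of ★
`MR92Prop6Source.exists_line_detecting_of_forall` / ★ `HComp.RecordSystem.exists_pieces_detectingLine` once `B₀` is the ★ F3 frame of
III-8′'s line — then `c` pulls back non-trivially to the source piece along `φ` over `(ιe)_τ ∘ ιs`
(`bookkeeper_of_rational_reps` + `lastCol_bookkeeper_mul_eq` + `exists_fac_pullback_ne_zero`).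
[cite: Liu2021, proof of Thm. 4.15, l. 2207 and l. 2212 with footnote 9] [cite: Milne2005ShimuraVarieties, Lemma 5.13 p. 57 and Thm. 13.6 p. 118] -/
theorem exists_fac_pullback_ne_zero_of_rational_reps
    (hcol : IsColimit (Cofan.mk ((Motives.baseChangeHom τ).obj (S.M.obj K)) ι))
    (hιe : Sstar.IsEmbedding S Jperp B ha hB hτa hτa' Kstar K hK ιe)
    (hBq : Bq.Hℂ = H.map τ)
    (hιq : letI : Algebra L ℂ := τ.toAlgebra
      ∀ x : Ball, AlgPoints.map (L := ℂ) (ι q) (Bq.unif ((T : Matrix (Fin 3) (Fin 3) ℂ) *ᵥ BallModel.lift x)) =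
        AlgPoints.baseChangeEquiv τ (S.M.obj K) ((S.pts K).symm (ShimuraSet.mk L H τ T hT K.1.1 x gq)))
    (hD₁ : D₁.Hℂ = Jstar.map τ)
    (hΓ₁ : D₁.Γ.map (Matrix.GeneralLinearGroup.map (D₁.τ₁ : ↥D₁.E →+* ℂ)) =
      (arithmeticLevel (↥(maximalRealSubfield L)) L (IsCMField.complexConj L) 2 Jstar
        (Kstar.1.1.map (MulAut.conj gs).toMonoidHom)).map (Matrix.GeneralLinearGroup.map τ))
    (hιs : letI : Algebra L ℂ := τ.toAlgebra
      ∀ (v : Fin 2 → ℂ) (hv : v ∈ negCone (Jstar.map τ)), AlgPoints.map (L := ℂ) ιs (D₁.unif v) =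
        AlgPoints.baseChangeEquiv τ (Sstar.M.obj Kstar) ((Sstar.pts Kstar).symm (ShimuraSetGS.mk L Jstar τ Kstar.1.1 v hv gs)))
    (γ₁ : ↥(rational (↥(maximalRealSubfield L)) L (IsCMField.complexConj L) 3 H))
    (hγ₁ : gq⁻¹ * rationalToFinAdelic (↥(maximalRealSubfield L)) L (IsCMField.complexConj L) 3 H γ₁ ∈ K.1.1)
    (γs : ↥(rational (↥(maximalRealSubfield L)) L (IsCMField.complexConj L) 2 Jstar))
    (hγs : gs⁻¹ * rationalToFinAdelic (↥(maximalRealSubfield L)) L (IsCMField.complexConj L) 2 Jstar γs ∈ Kstar.1.1)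
    (B₀ : GL (Fin 3) L) (hBB₀ : (γ₁ : GL (Fin 3) L) * B = B₀)
    (c : HodgeTheory.complexBetti (X q) 1)
    (hdet : ∀ (Y' : SchemeOver ℂ) (D' : UnitaryBallUniformisationDatum 1 Y') (φ' : Y' ⟶ X q) (M : Matrix (Fin 3) (Fin 2) ℂ),
      M.conjTranspose * H.map τ * M = D'.Hℂ →
      (∀ v ∈ (L ∙ fun i => ((B₀ : GL (Fin 3) L) : Matrix (Fin 3) (Fin 3) L) i (Fin.last 2)), ∀ u : Fin 2 → ℂ,
        hermForm (starRingEnd ℂ) (H.map τ) (⇑τ ∘ v) (M.mulVec u) = 0) →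
      (∀ γ' ∈ D'.Γ, ∃ γ'' ∈ arithmeticLevel (↥(maximalRealSubfield L)) L (IsCMField.complexConj L) 3 H
          (K.1.1.map (MulAut.conj gq).toMonoidHom),
        (γ'' : Matrix (Fin 3) (Fin 3) L).map τ * M = M * ((γ' : Matrix (Fin 2) (Fin 2) ↥D'.E)).map D'.E.subtype) →
      (∀ v ∈ negCone D'.Hℂ, AlgPoints.map (L := ℂ) φ' (D'.unif v) = Bq.unif (M.mulVec v)) →
        Literature.AlgebraicTopology.SingularHomology.singularCohomology.map ℂ ℂ (AlgPoints.mapContinuous (L := ℂ) φ') 1 c ≠ 0) :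
    ∃ φ : Y ⟶ X q, φ ≫ ι q = ιs ≫ (Motives.baseChangeHom τ).map ιe ∧
      Literature.AlgebraicTopology.SingularHomology.singularCohomology.map ℂ ℂ (AlgPoints.mapContinuous (L := ℂ) φ) 1 c ≠ 0 := by
  have hγ := bookkeeper_of_rational_reps Jperp B ha hB hK gq gs γ₁ hγ₁ γs hγs
  have hcolγ := lastCol_bookkeeper_mul_eq Jperp B ha hB γ₁ γs
  rw [hBB₀] at hcolγ
  refine exists_fac_pullback_ne_zero Sstar S Jperp B ha hB hτa hτa' hK q Bq gq D₁ ιs gs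
    (γ₁ * (embRational (↥(maximalRealSubfield L)) L (IsCMField.complexConj L) 2 1 Jstar Jperp H B ha hB γs)⁻¹)
    hcol hιe hBq hιq hD₁ hΓ₁ hιs hγ c fun Y' D' φ' M hg ho hgr hu => hdet Y' D' φ' M hg ?_ hgr hu
  rw [hcolγ] at ho
  exact ho

/-- **The identity-class representative is rational up to the level** (E0 of the closer, both ranks): from representatives `gq` of
`Ξ_K` (`hg : ∀ q, ⟦pt K (gq q)⟧ = q`) the representative of the class of `1` satisfies `(gq ⟦1⟧)⁻¹ · γ_f ∈ K` for some `γ ∈ U(J)(F)` —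
★ `UnitaryGroup.exists_rational_smul_rep_mem hg 1`, inverted (the shape of `hγ₁`/`hγs` above).
[cite: Milne2005ShimuraVarieties, Lemma 5.13 p. 57] -/
theorem exists_rep_inv_mul_rational_mem {N : ℕ} {J : Matrix (Fin N) (Fin N) L}
    {K' : Subgroup (finAdelic (↥(maximalRealSubfield L)) L (IsCMField.complexConj L) N J)}
    {g : orbitRel.Quotient (rational (↥(maximalRealSubfield L)) L (IsCMField.complexConj L) N J)
        (CosetSpace (rationalToFinAdelic (↥(maximalRealSubfield L)) L (IsCMField.complexConj L) N J) K') →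
      finAdelic (↥(maximalRealSubfield L)) L (IsCMField.complexConj L) N J}
    (hg : ∀ q, Quotient.mk'' (CosetSpace.pt (rationalToFinAdelic (↥(maximalRealSubfield L)) L (IsCMField.complexConj L) N J) K' (g q)) = q) :
    ∃ γ : ↥(rational (↥(maximalRealSubfield L)) L (IsCMField.complexConj L) N J),
      (g (Quotient.mk'' (CosetSpace.pt (rationalToFinAdelic (↥(maximalRealSubfield L)) L (IsCMField.complexConj L) N J) K' 1)))⁻¹ *
        rationalToFinAdelic (↥(maximalRealSubfield L)) L (IsCMField.complexConj L) N J γ ∈ K' := by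
  obtain ⟨γ, hγ⟩ := exists_rational_smul_rep_mem (F := ↥(maximalRealSubfield L)) (c := IsCMField.complexConj L) hg 1
  refine ⟨γ, ?_⟩
  have h := K'.inv_mem hγ
  rwa [_root_.mul_inv_rev, inv_inv, mul_one] at h

end UnitaryCanonicalModel

end Literature.AlgebraicGeometry.ShimuraVarieties

end
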